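import Mathlib.GroupTheory.IndexNSmul
import Literature.AlgebraicGeometry.Motives.JacobianHomology
import Literature.AlgebraicTopology.FundamentalGroup.TopologicalGroupCovering
import Literature.AlgebraicTopology.SingularHomology.CompactManifoldFiniteness
import Literature.AlgebraicTopology.SingularHomology.RationalEulerCharacteristic
import Literature.NumberTheory.DiophantineGeometry.AVGaloisModuleContinuityProofs
import HarnessLib

/-!
# The fundamental group and the first Betti number of a complex abelian variety: `|A[n](ℂ)| = n^{b₁}`

For an abelian variety `A` over `ℂ`, the complex points `A(ℂ)` form a compact, Hausdorff,
path-connected commutative topological group (`AbelianVarietyComplexPoints.lean`), and for `n ≥ 1`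
the multiplication `[n] : A → A` is an isogeny (Görtz–Wedhorn II, Prop. 27.186–27.187; in the tree
`AbelianVariety.isIsogeny_zsmul_id_of_cast_ne_zero`, characteristic `0`): on complex points it is
the `n`-th power map `x ↦ xⁿ` (`map_zsmul_id_apply`), surjective (`pow_surjective`, surjective
morphisms are surjective on complex points) with finite kernel `A[n](ℂ)`
(`AbelianVariety.finite_torsionPoints_of_cast_ne_zero`). Hence (Hatcher, *Algebraic Topology*,
Prop. 1.31–1.40 for the covering `x ↦ xⁿ`, the tree's `TopologicalGroupCovering.lean`):

* `isCoveringMap_pow`: `x ↦ xⁿ` is a covering map of `A(ℂ)`;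
* `pow_injective_fundamentalGroup`, `isMulTorsionFree_fundamentalGroup`: `π₁(A(ℂ), 1)` is a
  torsion-free commutative group;
* `index_range_powMap_eq_natCard_torsionPoints`: the `n`-th powers have index `|A[n](ℂ)|` in
  `π₁(A(ℂ), 1)`;
* `bijective_hurewiczOne`: the Hurewicz map `π₁(A(ℂ), 1) → H₁(A(ℂ); ℤ)` is bijective
  (Hatcher Thm. 2A.1, `π₁` being commutative), `H₁(A(ℂ); ℤ)` is finitely generated (compact
  manifold, Hatcher Cor. A.8–A.9) and torsion free (`isAddTorsionFree_singularHomology_one`),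
  hence free, and `[H₁ : n H₁] = |A[n](ℂ)|` (`index_range_nsmul_singularHomology_one`);
* **`natCard_torsionPoints_eq_pow_finrank`: `|A[n](ℂ)| = n ^ b₁(A(ℂ))`** for every `n ≥ 1`, with
  `b₁(A(ℂ)) = dim_ℚ H¹(A(ℂ); ℚ) = rk_ℤ H₁(A(ℂ); ℤ)` (Hatcher §3.1 p. 198 / Cor. 3A.6) — unconditional;
* `finrank_bettiCohomology_one_eq_of_natCard_torsionPoints`: consequently the named fact
  `AbelianVariety.natCard_torsionPoints_of_isAlgClosed A ℂ` (`|A[n](ℂ)| = n^{2 dim A}`, Mumford §6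
  App. 3; in the tree reduced to the degree `deg [n] = n^{2g}`, theorem of the cube) implies
  **`b₁(A(ℂ)) = 2 dim A`** (Mumford, *Abelian Varieties*, §1 (3): `H¹(X, ℤ) ≅ ℤ^{2g}`).

Classically both `|A[n](ℂ)| = n^{2g}` and `b₁ = 2g` are read off from `A(ℂ) = ℂ^g/Λ` (Mumford §1);
here the complex-torus structure is replaced by covering-space theory of the algebraic isogeny
`[n]`, which is what the tree has. This is the ingredient "`H₁(J, ℤ) = Λ` is free of rank
`2 dim J`" of Lange's proof of `(f^P)^* : H¹(J(ℂ); ℚ) ≅ H¹(C(ℂ); ℚ)` (Lange 2023, §4.1.1 and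
Lemma 4.4.1; the named fact `isIso_bettiCohomology_map_abelJacobi`). Everything is proved; no
definitions, no new named facts.

## References

* D. Mumford, *Abelian Varieties* (1970), §1 (1)–(3), §6 Application 3. [MumfordAV1970]
* U. Görtz, T. Wedhorn, *Algebraic Geometry II* (2023), Prop. 27.186–27.188. [GortzWedhorn2023]
* A. Hatcher, *Algebraic Topology* (2002), §1.3 Prop. 1.31–1.40, Thm. 2A.1, §3.1 p. 198,
  App. A Cor. A.8–A.9. [HatcherAT2002]
* H. Lange, *Abelian Varieties over the Complex Numbers* (2023), §4.1.1, Lemma 4.4.1. [Lange2023AbelianVarietiesC]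
-/

noncomputable section

open CategoryTheory AlgebraicGeometry
open Literature.AlgebraicTopology.SingularHomology Literature.AlgebraicTopology.FundamentalGroup

namespace Literature.AlgebraicGeometry.Motives

namespace AbelianVariety

variable (A : AbelianVariety ℂ)

/-! ### `[n]` on complex points: the `n`-th power map, surjective with finite kernel -/

/-- On `L`-points, `[n]_A = n • 𝟙 A` is the `n`-th power map of the group `A(L)` (the group law on
`A(L) = Hom(Spec L, A)` is induced by that of `A`; Görtz–Wedhorn II, (27.35.2)). [cite: GortzWedhorn2023, (27.35.2)] -/
theorem map_zsmul_id_apply {k : Type} [Field k] (B : AbelianVariety k) (L : Type) [Field L]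
    [Algebra k L] (n : ℤ) (P : B.Points L) :
    AlgPoints.map ((n • 𝟙 B :).hom.hom.hom) P = P ^ n := by
  rw [AlgPoints.map_apply, hom_zsmul_id, GrpObj.comp_zpow, Category.comp_id]

/-- **`x ↦ xⁿ` is surjective on `A(ℂ)` for `n ≥ 1`**: `[n]_A` is an isogeny in characteristic `0`
(`isIsogeny_zsmul_id_of_cast_ne_zero`, Görtz–Wedhorn II Prop. 27.186–27.187), in particular
surjective, hence surjective on complex points (`AlgPoints.map_surjective_of_surjective`).
[cite: GortzWedhorn2023, Prop. 27.186 and Prop. 27.187] -/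
theorem pow_surjective (n : ℕ) (hn : n ≠ 0) : Function.Surjective fun P : A.Points ℂ => P ^ n := by
  have hiso := isIsogeny_zsmul_id_of_cast_ne_zero (A := A) (n : ℤ) (by exact_mod_cast hn)
  haveI : AlgebraicGeometry.Surjective (Hom.toSchemeHom ((n : ℤ) • 𝟙 A)) := hiso.1
  have h := AlgPoints.map_surjective_of_surjective (((n : ℤ) • 𝟙 A :).hom.hom.hom)
  intro Q
  obtain ⟨P, hP⟩ := h Q
  refine ⟨P, ?_⟩
  rw [map_zsmul_id_apply, zpow_natCast] at hP
  exact hP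

/-- The kernel of `x ↦ xⁿ` on `A(ℂ)` is the `n`-torsion `A[n](ℂ)`. [folklore] -/
theorem ker_powMonoidHom_eq_torsionPoints (n : ℕ) :
    (powMonoidHom n : A.Points ℂ →* A.Points ℂ).ker = A.torsionPoints ℂ n := by
  ext P
  rw [MonoidHom.mem_ker, powMonoidHom_apply, mem_torsionPoints_iff, zpow_natCast]

/-- **`A[n](ℂ)` is finite for `n ≥ 1`** (Mumford §6 App. 3; the tree's
`AbelianVariety.finite_torsionPoints_of_cast_ne_zero`), as a finiteness of the kernel of
`x ↦ xⁿ`. [cite: MumfordAV1970, §6 Application 3 (Proposition p. 64)] -/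
theorem finite_ker_powMonoidHom (n : ℕ) (hn : n ≠ 0) :
    ((powMonoidHom n : A.Points ℂ →* A.Points ℂ).ker : Set (A.Points ℂ)).Finite := by
  rw [ker_powMonoidHom_eq_torsionPoints]
  haveI := finite_torsionPoints_of_cast_ne_zero A ℂ (n : ℤ) (by exact_mod_cast hn)
  exact Set.toFinite _

/-! ### Covering-space consequences for `π₁(A(ℂ), 1)` -/

/-- **`x ↦ xⁿ` is a covering map of `A(ℂ)`** for `n ≥ 1` (a continuous surjective homomorphism
with finite kernel of the compact Hausdorff group `A(ℂ)`; Mumford §1 (via `ℂ^g/Λ`), here from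
`isCoveringMap_monoidHom`). [cite: MumfordAV1970, §6 Application 3 (Proposition p. 64)] -/
theorem isCoveringMap_pow (n : ℕ) (hn : n ≠ 0) : IsCoveringMap fun P : A.Points ℂ => P ^ n :=
  isCoveringMap_monoidHom (powMonoidHom n : A.Points ℂ →* A.Points ℂ) (continuous_pow n)
    (A.pow_surjective n hn) (A.finite_ker_powMonoidHom n hn)

/-- **`π₁(A(ℂ), 1)` is torsion free**: `p ↦ pⁿ` is injective for `n ≥ 1` (the covering `x ↦ xⁿ`
is injective on `π₁` and induces the `n`-th power, Hatcher Prop. 1.31 and Eckmann–Hilton).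
[cite: HatcherAT2002, §1.3 Prop. 1.31] -/
theorem pow_injective_fundamentalGroup (n : ℕ) (hn : n ≠ 0) :
    Function.Injective fun p : FundamentalGroup (A.Points ℂ) (1 : A.Points ℂ) => p ^ n :=
  Literature.AlgebraicTopology.FundamentalGroup.pow_injective_fundamentalGroup n
    (A.pow_surjective n hn) (A.finite_ker_powMonoidHom n hn)

/-- `π₁(A(ℂ), 1)` is a torsion-free monoid (`IsMulTorsionFree`). [cite: HatcherAT2002, §1.3 Prop. 1.31] -/
theorem isMulTorsionFree_fundamentalGroup :
    IsMulTorsionFree (FundamentalGroup (A.Points ℂ) (1 : A.Points ℂ)) :=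
  ⟨fun _ hn => A.pow_injective_fundamentalGroup _ hn⟩

/-- **`[π₁(A(ℂ), 1) : {pⁿ}] = |A[n](ℂ)|`**: the `n`-th powers — the image of `(x ↦ xⁿ)_*` — have
index the order of the kernel `A[n](ℂ)` of the covering `x ↦ xⁿ` (Hatcher Prop. 1.39).
[cite: HatcherAT2002, §1.3 Prop. 1.39] -/
theorem index_range_powMap_eq_natCard_torsionPoints (n : ℕ) (hn : n ≠ 0) :
    (FundamentalGroup.mapOfEq (powMap (A.Points ℂ) n) (powMap_one n)).range.index =
      Nat.card (A.torsionPoints ℂ n) := by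
  rw [index_range_powMonoidHom_fundamentalGroup n (A.pow_surjective n hn)
    (A.finite_ker_powMonoidHom n hn), ker_powMonoidHom_eq_torsionPoints]

/-! ### `H₁(A(ℂ); ℤ)`: Hurewicz, finite generation, torsion-freeness, index of `n H₁` -/

/-- **The Hurewicz map `π₁(A(ℂ), 1) → H₁(A(ℂ); ℤ)` is bijective**: it is onto with kernel the
commutator subgroup (Hatcher Thm. 2A.1, the tree's `HurewiczProof.hurewiczOne_surjective`,
`ker_hurewiczOne`), which is trivial since `π₁` of a topological group is commutative
(Eckmann–Hilton). [cite: HatcherAT2002, Thm. 2A.1] -/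
theorem bijective_hurewiczOne :
    Function.Bijective (hurewiczOne ℤ ℤ (1 : ℤ) (1 : A.Points ℂ)) := by
  refine ⟨?_, HurewiczProof.hurewiczOne_surjective _⟩
  rw [← MonoidHom.ker_eq_bot_iff, HurewiczProof.ker_hurewiczOne]
  exact commutator_eq_bot _

/-- **`H₁(A(ℂ); ℤ)` is finitely generated** (`A(ℂ)` is a compact topological `2 dim A`-manifold;
Hatcher App. A Cor. A.8–A.9, the tree's `finite_singularHomology_of_compact_chartedSpace`).
[cite: HatcherAT2002, App. A Cor. A.8 and A.9 p. 527] -/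
theorem finite_singularHomology (i : ℕ) : Module.Finite ℤ (singularHomology ℤ ℤ (A.Points ℂ) i) :=
  letI := (AbelianVariety.isSmoothProjective_holds (A := A)).chartedSpace
  finite_singularHomology_of_compact_chartedSpace ℤ ℤ (d := 2 * A.dim) i

/-- **`H₁(A(ℂ); ℤ)` is torsion free**: `n • x = 0`, `n ≥ 1`, forces `x = 0`, transported from the
torsion-freeness of `π₁(A(ℂ), 1)` along the bijective Hurewicz homomorphism. [cite: HatcherAT2002, Thm. 2A.1] -/
theorem isAddTorsionFree_singularHomology_one :
    IsAddTorsionFree (singularHomology ℤ ℤ (A.Points ℂ) 1) := by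
  refine ⟨fun n hn x y hxy => ?_⟩
  set h := hurewiczOne ℤ ℤ (1 : ℤ) (1 : A.Points ℂ) with hh
  obtain ⟨p, hp⟩ := A.bijective_hurewiczOne.2 (Multiplicative.ofAdd x)
  obtain ⟨q, hq⟩ := A.bijective_hurewiczOne.2 (Multiplicative.ofAdd y)
  have hx : x = Multiplicative.toAdd (h p) := by rw [hh, hp, toAdd_ofAdd]
  have hy : y = Multiplicative.toAdd (h q) := by rw [hh, hq, toAdd_ofAdd]
  have hpq : p ^ n = q ^ n := by
    apply A.bijective_hurewiczOne.1
    change h (p ^ n) = h (q ^ n)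
    rw [map_pow, map_pow]
    apply Multiplicative.toAdd.injective
    rw [toAdd_pow, toAdd_pow, ← hx, ← hy]
    exact hxy
  rw [hx, hy, A.pow_injective_fundamentalGroup n hn hpq]

/-- **`[H₁(A(ℂ); ℤ) : n H₁(A(ℂ); ℤ)] = |A[n](ℂ)|`** for `n ≥ 1`: transport of
`index_range_powMap_eq_natCard_torsionPoints` along the bijective Hurewicz homomorphism, which maps
`n`-th powers in `π₁` onto `n`-th multiples in `H₁`. [cite: HatcherAT2002, §1.3 Prop. 1.39 and Thm. 2A.1] -/
theorem index_range_nsmul_singularHomology_one (n : ℕ) (hn : n ≠ 0) :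
    (nsmulAddMonoidHom n : singularHomology ℤ ℤ (A.Points ℂ) 1 →+ _).range.index =
      Nat.card (A.torsionPoints ℂ n) := by
  rw [← A.index_range_powMap_eq_natCard_torsionPoints n hn, ← AddSubgroup.index_toSubgroup,
    ← Subgroup.index_comap_of_surjective _ A.bijective_hurewiczOne.2]
  congr 1
  ext p
  simp only [Subgroup.mem_comap, Multiplicative.mem_toSubgroup, AddMonoidHom.mem_range,
    nsmulAddMonoidHom_apply, mem_range_mapOfEq_powMap_iff]
  constructor
  · rintro ⟨x, hx⟩
    obtain ⟨q, hq⟩ := A.bijective_hurewiczOne.2 (Multiplicative.ofAdd x)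
    refine ⟨q, A.bijective_hurewiczOne.1 ?_⟩
    apply Multiplicative.toAdd.injective
    rw [map_pow, toAdd_pow, hq, toAdd_ofAdd, hx]
  · rintro ⟨q, rfl⟩
    exact ⟨Multiplicative.toAdd (hurewiczOne ℤ ℤ (1 : ℤ) (1 : A.Points ℂ) q), by
      rw [map_pow, toAdd_pow]⟩

/-! ### `|A[n](ℂ)| = n ^ b₁(A(ℂ))` -/

/-- **`|A[n](ℂ)| = n ^ rk_ℤ H₁(A(ℂ); ℤ)`** for `n ≥ 1`: `H₁(A(ℂ); ℤ)` is a finitely generated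
torsion-free, hence free, `ℤ`-module, so `[H₁ : n H₁] = n ^ rk H₁` (Mathlib
`AddSubgroup.index_range_nsmul`), and `[H₁ : n H₁] = |A[n](ℂ)|`. [cite: MumfordAV1970, §1 (3)] -/
theorem natCard_torsionPoints_eq_pow_finrank_int (n : ℕ) (hn : n ≠ 0) :
    Nat.card (A.torsionPoints ℂ n) =
      n ^ Module.finrank ℤ (singularHomology ℤ ℤ (A.Points ℂ) 1) := by
  haveI := A.isAddTorsionFree_singularHomology_one
  have hfin : Module.Finite ℤ (singularHomology ℤ ℤ (A.Points ℂ) 1) := A.finite_singularHomology 1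
  -- the two `ℤ`-module structures (from `ModuleCat` and from the additive group) agree
  haveI : @Module.Finite ℤ (singularHomology ℤ ℤ (A.Points ℂ) 1) _ _
      (AddCommGroup.toIntModule _) := by
    convert hfin
    exact Subsingleton.elim _ _
  rw [← A.index_range_nsmul_singularHomology_one n hn]
  convert AddSubgroup.index_range_nsmul (singularHomology ℤ ℤ (A.Points ℂ) 1) n
  exact Subsingleton.elim _ _

/-- **`|A[n](ℂ)| = n ^ b₁(A(ℂ))`** for every `n ≥ 1` and every complex abelian variety `A`, with
`b₁(A(ℂ)) = dim_ℚ H¹(A(ℂ); ℚ)` (`= rk_ℤ H₁(A(ℂ); ℤ)`, Hatcher §3.1 p. 198 and Cor. 3A.6, the tree's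
`finrank_singularCohomology_rat_eq`). Classically both sides are computed from `A(ℂ) = ℂ^g/Λ`
(Mumford §1 (3) and §6 App. 3); here neither the complex torus nor the theorem of the cube is used.
[cite: MumfordAV1970, §1 (3) and §6 Application 3] -/
theorem natCard_torsionPoints_eq_pow_finrank (n : ℕ) (hn : n ≠ 0) :
    Nat.card (A.torsionPoints ℂ n) = n ^ Module.finrank ℚ (bettiCohomology A.X 1) := by
  rw [A.natCard_torsionPoints_eq_pow_finrank_int n hn]
  congr 1
  exact (finrank_singularCohomology_rat_eq (A.Points ℂ) 1).symm

/-- **`b₁(A(ℂ)) = 2 dim A` from the count of torsion points**: if `|A[n](ℂ)| = n^{2 dim A}` for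
`n` invertible (the named fact `AbelianVariety.natCard_torsionPoints_of_isAlgClosed A ℂ`, Mumford §6
App. 3; in the tree reduced to `deg [n]_A = n^{2g}`), then `dim_ℚ H¹(A(ℂ); ℚ) = 2 dim A`
(Mumford §1 (3): `H¹(X, ℤ) ≅ ℤ^{2g}`). [cite: MumfordAV1970, §1 (3) and §6 Application 3] -/
theorem finrank_bettiCohomology_one_eq_of_natCard_torsionPoints
    (h : natCard_torsionPoints_of_isAlgClosed A ℂ) :
    Module.finrank ℚ (bettiCohomology A.X 1) = 2 * A.dim := by
  have h2 := h 2 (by norm_num)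
  rw [show ((2 : ℤ) : ℤ) = ((2 : ℕ) : ℤ) from rfl] at h2
  rw [A.natCard_torsionPoints_eq_pow_finrank 2 two_ne_zero] at h2
  exact Nat.pow_right_injective le_rfl h2

end AbelianVariety

end Literature.AlgebraicGeometry.Motives

end
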